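import Mathlib
import HarnessLib
import Summits.NavierStokesRegularity.NavierStokesRegularity.Theorems.TaylorModelRungThreeCertificateFormatVRadiiSound

/-!
# Crux K1b-DR (stmt-NavierStokesRegularity-23954), line `taylor-model` — v3 certificate SOUNDNESS: the ENTRY clause
# (`EntryOK`: every polytope point is `yb + D·ζ` with `|ζ| ≤ rB` on the window) from SPARSE Farkas multipliers
# (CERT-CONTRACT-23954 §4 «entry»; v1 pattern of `…CertificateSoundEntry` p607762; successor engine-1 g67)

Data (the `entryAux` slot of `StageV`, layout fixed HERE): `entryAux[c]` = the list of PAIRS `#[l, λ]` (face index `l` coded as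
the rational `re` part of a `QS2`, multiplier `λ : QS2`) for window coordinate `c`. Checks per stage `j` and coordinate `c < n`:
(i) EXACT identity in `ℚ(√2)`: `Σ_t λ_t · ell[l_t][c'] = δ_{c c'}` for all `c' < n`; (ii) `0 < D_c`; (iii) the dual bound in
outward-rounded interval arithmetic: `mag(Σ_t λ_t·ctr_{l_t} ⊖ yb_c) + Σ_t |λ_t|·rad_{l_t} ≤ D_c·rB_c`. SOUNDNESS
(`entryOK_of_checkEntryV`): for `q` in the entry polytope, `q_c − yb_c = Σ_t λ_t ℓ_{l_t}(q)` by (i), hence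
`|q_c − yb_c| ≤ |Σ_t λ_t ctr_{l_t} − yb_c| + Σ_t |λ_t| rad_{l_t} ≤ D_c rB_c` (sparse Farkas bound `sparse_farkas_bound`), so
`ζ_c := (q_c − yb_c)/D_c` has `|ζ| ≤ rB` and `q = yb + D·ζ` on the window — the clause `EntryOK` of `…FormatVRadiiSound`.
MODEL-lattice bookkeeping only (rung TL-M3); nothing here is a statement about the Navier–Stokes equations.
-/

-- the sub-problem namespace repeats the summit name by design (D-0017)
set_option linter.dupNamespace false

namespace Summit.NavierStokesRegularity.NavierStokesRegularity.Theorems.TaylorModelCert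

open scoped BigOperators
open Literature.Analysis.FluidPDE.TaoCascade Literature.Analysis.FluidPDE.TaoCascade.TaylorChain
open Summit.NavierStokesRegularity.NavierStokesRegularity.Theorems.TaylorModelReadout
open Summit.NavierStokesRegularity.NavierStokesRegularity.Theorems.TaylorModelV

/-! ### Sparse sums over a pair table -/

section Sparse

/-- The face index of a pair `#[l, λ]` (`l` coded as the numerator of the rational part). [folklore] -/
def faceOf (pr : Array QS2) : ℕ := (pr.getD 0 0).re.num.toNat

/-- The multiplier of a pair `#[l, λ]`. [folklore] -/
def lamOf (pr : Array QS2) : QS2 := pr.getD 1 0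

/-- Pair `t` of a pair table (junk `#[]`). [folklore] -/
def pairAt (prs : Array (Array QS2)) (t : ℕ) : Array QS2 := prs.getD t #[]

/-- Exact sum `Σ_{t<k} f (pair t)` in `ℚ(√2)`. [folklore] -/
def sumQ (prs : Array (Array QS2)) (f : Array QS2 → QS2) : ℕ → QS2
  | 0 => 0
  | t + 1 => sumQ prs f t + f (pairAt prs t)

/-- Upward-rounded sum `Σ_{t<k} g (pair t)` of dyadics. [folklore] -/
def sumUp (prec : ℕ) (prs : Array (Array QS2)) (g : Array QS2 → Dyad) : ℕ → Dyad
  | 0 => Dyad.zero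
  | t + 1 => Dyad.addUp prec (sumUp prec prs g t) (g (pairAt prs t))

/-- The real value of `sumQ`. [folklore] -/
theorem toRealHom_sumQ (prs : Array (Array QS2)) (f : Array QS2 → QS2) :
    ∀ k, QS2.toRealHom (sumQ prs f k) = ∑ t ∈ Finset.range k, QS2.toRealHom (f (pairAt prs t))
  | 0 => by simp [sumQ]
  | k + 1 => by rw [sumQ, map_add, toRealHom_sumQ prs f k, Finset.sum_range_succ]

/-- A termwise-dominated sum is below `sumUp`. [folklore] -/
theorem sum_le_sumUp (prec : ℕ) (prs : Array (Array QS2)) (g : Array QS2 → Dyad) {x : ℕ → ℝ} :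
    ∀ k, (∀ t < k, x t ≤ (g (pairAt prs t)).toReal) → ∑ t ∈ Finset.range k, x t ≤ (sumUp prec prs g k).toReal
  | 0, _ => by simp [sumUp]
  | k + 1, h => by
    rw [Finset.sum_range_succ, sumUp]
    exact le_trans (add_le_add (sum_le_sumUp prec prs g k fun t ht => h t (Nat.lt_succ_of_lt ht))
      (h k (Nat.lt_succ_self k))) (Dyad.add_le_addUp prec _ _)

/-- **Sparse Farkas bound**: face bounds `|A(l_t) − ctr(l_t)| ≤ rad(l_t)` give
`|Σ_t λ_t A(l_t) − K₀| ≤ |Σ_t λ_t ctr(l_t) − K₀| + Σ_t |λ_t| rad(l_t)`. [folklore] -/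
theorem sparse_farkas_bound (k : ℕ) (lam A ctr rad : ℕ → ℝ) (K₀ : ℝ) (hP : ∀ t < k, |A t - ctr t| ≤ rad t) :
    |∑ t ∈ Finset.range k, lam t * A t - K₀| ≤
      |∑ t ∈ Finset.range k, lam t * ctr t - K₀| + ∑ t ∈ Finset.range k, |lam t| * rad t := by
  have e : ∑ t ∈ Finset.range k, lam t * A t - K₀ =
      (∑ t ∈ Finset.range k, lam t * ctr t - K₀) + ∑ t ∈ Finset.range k, lam t * (A t - ctr t) := by
    rw [Finset.sum_congr rfl fun t _ => mul_sub (lam t) (A t) (ctr t), Finset.sum_sub_distrib]; ring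
  rw [e]
  refine (abs_add_le _ _).trans ?_
  gcongr
  refine (Finset.abs_sum_le_sum_abs _ _).trans (Finset.sum_le_sum fun t ht => ?_)
  rw [abs_mul]
  exact mul_le_mul_of_nonneg_left (hP t (Finset.mem_range.1 ht)) (abs_nonneg _)

end Sparse

/-! ### The check -/

namespace CertTablesV

variable (TV : CertTablesV)

/-- The pair table of stage `j`, coordinate `c`. [folklore] -/
def pairsAt (j c : ℕ) : Array (Array QS2) := (TV.stageV j).entryAux.getD c #[]

/-- Face row `l` of stage `j` (list-coded covector). [folklore] -/
def ellRow (j l : ℕ) : List QS2 := (TV.base.stage j).ell.getD l []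

/-- (i) EXACT multiplier identity `Σ_t λ_t·ell[l_t][c'] = δ_{c c'}` for all `c' < n`. [folklore] -/
def entryIdOK (j c : ℕ) : Bool :=
  allBelow (fun c' => decide (sumQ (TV.pairsAt j c) (fun pr => lamOf pr * vget (TV.ellRow j (faceOf pr)) c')
    (TV.pairsAt j c).size = if c' = c then 1 else 0)) TV.base.n

/-- Interval enclosure of `Σ_t λ_t·ctr_{l_t} − yb_c`. [folklore] -/
def entryCtrI (j c : ℕ) : IntervalD :=
  IntervalD.subR TV.prec
    (IntervalD.rangeSumR TV.prec (fun t => IntervalD.mulR TV.prec (IntervalD.ofQS2 TV.prec (lamOf (pairAt (TV.pairsAt j c) t)))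
      (IntervalD.ofQS2 TV.prec (vget (TV.base.stage j).ctr (faceOf (pairAt (TV.pairsAt j c) t))))) (TV.pairsAt j c).size)
    (IntervalD.ofDyad (dget (TV.stageV j).yb c))

/-- Upper bound of `Σ_t |λ_t|·rad_{l_t}`. [folklore] -/
def entryRadUp (j c : ℕ) : Dyad :=
  sumUp TV.prec (TV.pairsAt j c) (fun pr => Dyad.mulUp TV.prec (IntervalD.mag (IntervalD.ofQS2 TV.prec (lamOf pr)))
    (IntervalD.mag (IntervalD.ofQS2 TV.prec (vget (TV.base.stage j).rad (faceOf pr))))) (TV.pairsAt j c).size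

/-- (ii)+(iii) `0 < D_c` and the dual bound `mag(Σλ·ctr ⊖ yb_c) + Σ|λ|·rad ≤ D_c·rB_c`. [folklore] -/
def entryBdOK (j c : ℕ) : Bool :=
  Dyad.blt Dyad.zero (dget (TV.stageV j).D c) &&
    Dyad.ble (Dyad.addUp TV.prec (IntervalD.mag (TV.entryCtrI j c)) (TV.entryRadUp j c))
      (Dyad.mul (dget (TV.stageV j).D c) (dget (TV.stageV j).rB c))

/-- **ENTRY CHECK** of stage `j`: (i)–(iii) for every window coordinate. [folklore] -/
def checkEntryV (j : ℕ) : Bool := allBelow (fun c => TV.entryIdOK j c && TV.entryBdOK j c) TV.base.n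

/-! ### Soundness -/

variable {TV}

/-- Entries of the diagonal matrix. [folklore] -/
theorem dre_diagD {n : ℕ} (D : Array Dyad) {r c : ℕ} (hr : r < n) (hc : c < n) :
    dre (diagD n D) r c = if r = c then vre D r else 0 := by
  unfold dre diagD
  rw [dmget_ofFn_row _ c hr, dget_ofFn _ hc]
  show (if r = c then dget D r else Dyad.zero).toReal = if r = c then vre D r else 0
  split_ifs
  · rfl
  · exact Dyad.toReal_zero

/-- The face functionals of the interpreted record in coordinates. [folklore] -/
theorem ell_apply_V (kitOf : ℕ → CoreKit) (wT : ℕ → Array Dyad) (sc : ScalarsV) (j l : ℕ) (y : Fin 4 → ℤ → ℝ) :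
    (TV.toCertDataVW kitOf wT sc).ℓ j l y = ∑ c ∈ Finset.range TV.base.n, QS2.toRealHom (vget (TV.ellRow j l) c) * TV.base.wv y c :=
  TV.base.covR_apply QS2.toRealHom _ y

/-- **Soundness of the entry check**: `checkEntryV j = true` for all `j ≤ N₀` gives `EntryOK`. [folklore] -/
theorem entryOK_of_checkEntryV (kitOf : ℕ → CoreKit) (wT : ℕ → Array Dyad) (sc : ScalarsV)
    (h : ∀ j, j ≤ TV.base.N₀ → TV.checkEntryV j = true) : EntryOK TV kitOf wT sc := by
  intro j hj q hq
  have hcheck := allBelow_eq_true.1 (h j hj)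
  -- the candidate parameter `ζ_c := (q_c − yb_c)/D_c`
  refine ⟨TV.base.vecF fun c => (TV.base.wv q c - vre (TV.stageV j).yb c) / vre (TV.stageV j).D c, ?_, ?_⟩
  · -- `|ζ| ≤ rB` on the window
    refine TV.base.absLeW_vecF_of_absLeVec cd_Kb cd_Ka fun c hc => ?_
    rw [TV.base.wv_vecF _ hc]
    obtain ⟨hid, hbd⟩ := Bool.and_eq_true_iff.1 (hcheck c hc)
    unfold entryBdOK at hbd
    obtain ⟨hD, hle⟩ := Bool.and_eq_true_iff.1 hbd
    have hDpos : 0 < vre (TV.stageV j).D c := by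
      have := (Dyad.blt_iff _ _).1 hD; rw [Dyad.toReal_zero] at this; exact this
    have hle' := (Dyad.ble_iff _ _).1 hle
    rw [Dyad.toReal_mul] at hle'
    -- the identity `wv q c − yb_c = Σ_t λ_t ℓ_{l_t}(q) − yb_c`
    set prs := TV.pairsAt j c
    have hid' := allBelow_eq_true.1 hid
    have eq1 : TV.base.wv q c = ∑ t ∈ Finset.range prs.size,
        QS2.toRealHom (lamOf (pairAt prs t)) * (TV.toCertDataVW kitOf wT sc).ℓ j (faceOf (pairAt prs t)) q := by
      have step : ∀ c' < TV.base.n, (∑ t ∈ Finset.range prs.size,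
          QS2.toRealHom (lamOf (pairAt prs t)) * QS2.toRealHom (vget (TV.ellRow j (faceOf (pairAt prs t))) c')) =
          if c' = c then 1 else 0 := by
        intro c' hc'
        have e := of_decide_eq_true (hid' c' hc')
        have e' := congrArg QS2.toRealHom e
        rw [toRealHom_sumQ] at e'
        simp only [map_mul] at e'
        rw [e']
        split_ifs <;> simp
      simp only [ell_apply_V, Finset.mul_sum]
      rw [Finset.sum_comm]
      have : ∀ c' ∈ Finset.range TV.base.n, ∑ t ∈ Finset.range prs.size,
          QS2.toRealHom (lamOf (pairAt prs t)) * (QS2.toRealHom (vget (TV.ellRow j (faceOf (pairAt prs t))) c') * TV.base.wv q c') =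
          (if c' = c then 1 else 0) * TV.base.wv q c' := by
        intro c' hc'
        rw [← step c' (Finset.mem_range.1 hc'), Finset.sum_mul]
        exact Finset.sum_congr rfl fun t _ => by ring
      rw [Finset.sum_congr rfl this]
      simp only [ite_mul, one_mul, zero_mul, Finset.sum_ite_eq', Finset.mem_range, if_pos hc]
    -- Farkas
    have hP : ∀ t < prs.size, |(TV.toCertDataVW kitOf wT sc).ℓ j (faceOf (pairAt prs t)) q -
        QS2.toRealHom (vget (TV.base.stage j).ctr (faceOf (pairAt prs t)))| ≤
        QS2.toRealHom (vget (TV.base.stage j).rad (faceOf (pairAt prs t))) := fun t _ => hq (faceOf (pairAt prs t))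
    have hF := sparse_farkas_bound prs.size (fun t => QS2.toRealHom (lamOf (pairAt prs t)))
      (fun t => (TV.toCertDataVW kitOf wT sc).ℓ j (faceOf (pairAt prs t)) q)
      (fun t => QS2.toRealHom (vget (TV.base.stage j).ctr (faceOf (pairAt prs t))))
      (fun t => QS2.toRealHom (vget (TV.base.stage j).rad (faceOf (pairAt prs t)))) (vre (TV.stageV j).yb c) hP
    -- the two certified bounds
    have hS : |∑ t ∈ Finset.range prs.size, QS2.toRealHom (lamOf (pairAt prs t)) *
        QS2.toRealHom (vget (TV.base.stage j).ctr (faceOf (pairAt prs t))) - vre (TV.stageV j).yb c| ≤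
        (IntervalD.mag (TV.entryCtrI j c)).toReal := by
      refine IntervalD.abs_le_mag (IntervalD.mem_subR TV.prec (IntervalD.mem_rangeSumR TV.prec _ fun t _ => ?_) (IntervalD.mem_ofDyad _))
      exact IntervalD.mem_mulR TV.prec (IntervalD.mem_ofQS2 _ _) (IntervalD.mem_ofQS2 _ _)
    have hR : ∑ t ∈ Finset.range prs.size, |QS2.toRealHom (lamOf (pairAt prs t))| *
        QS2.toRealHom (vget (TV.base.stage j).rad (faceOf (pairAt prs t))) ≤ (TV.entryRadUp j c).toReal := by
      refine sum_le_sumUp TV.prec prs _ _ fun t _ => le_trans ?_ (Dyad.mul_le_mulUp TV.prec _ _)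
      exact mul_le_mul (IntervalD.abs_le_mag (IntervalD.mem_ofQS2 _ _))
        ((le_abs_self _).trans (IntervalD.abs_le_mag (IntervalD.mem_ofQS2 _ _))) ((abs_nonneg _).trans (hP t ‹_›))
        (IntervalD.mag_nonneg _)
    have hsum := Dyad.add_le_addUp TV.prec (IntervalD.mag (TV.entryCtrI j c)) (TV.entryRadUp j c)
    have key : |TV.base.wv q c - vre (TV.stageV j).yb c| ≤ vre (TV.stageV j).D c * vre (TV.stageV j).rB c := by
      rw [eq1]
      refine hF.trans ?_
      have hle'' : (Dyad.addUp TV.prec (IntervalD.mag (TV.entryCtrI j c)) (TV.entryRadUp j c)).toReal ≤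
          vre (TV.stageV j).D c * vre (TV.stageV j).rB c := hle'
      linarith
    rw [abs_div, abs_of_pos hDpos, div_le_iff₀ hDpos, mul_comm]
    exact key
  · -- `q = yb + D ζ` on the window
    intro i k hk1 hk2
    have hk : -TV.base.Kb ≤ k ∧ k ≤ TV.base.Ka := ⟨hk1, hk2⟩
    have hc := TV.base.idx_lt_n i hk
    obtain ⟨-, hbd⟩ := Bool.and_eq_true_iff.1 (hcheck _ hc)
    unfold entryBdOK at hbd
    obtain ⟨hD, -⟩ := Bool.and_eq_true_iff.1 hbd
    have hDpos : 0 < vre (TV.stageV j).D (TV.base.idx i k) := by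
      have := (Dyad.blt_iff _ _).1 hD; rw [Dyad.toReal_zero] at this; exact this
    rw [rd_Dsc, Pi.add_apply, Pi.add_apply, TV.base.linF_vecF, TV.base.vecF_apply, if_pos hk]
    rw [Finset.sum_congr rfl fun c' hc' => by rw [dre_diagD _ hc (Finset.mem_range.1 hc')]]
    simp only [ite_mul, zero_mul, Finset.sum_ite_eq, Finset.mem_range, if_pos hc]
    rw [mul_div_cancel₀ _ hDpos.ne', ← TV.base.wv_idx q i hk]
    show _ = TV.base.vecF (vre (TV.xD j 0)) i k + _
    rw [TV.base.vecF_apply, if_pos hk]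
    show TV.base.wv q (TV.base.idx i k) = vre (TV.stageV j).yb (TV.base.idx i k) + (TV.base.wv q (TV.base.idx i k) - vre (TV.stageV j).yb (TV.base.idx i k))
    ring

end CertTablesV

end Summit.NavierStokesRegularity.NavierStokesRegularity.Theorems.TaylorModelCert
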